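import Summits.HodgeConjecture.HodgeConjecture.Theorems.SoloBlindSquareForm
import HarnessLib

/-!
# The square chain: `SquareHodge` is antitone, and the threshold form of the summit

Solo-blind residency on `HodgeConjecture`, session s177; claim SB-C1347 of its `CLAIMS.jsonl`
(promoting the sketch SB-C1346), companion prose `work/s177/chain177.md`, front sheet
`paper/sharpest.md` §1 (1k).

A KERNEL COROLLARY of theorems already in the tree, recorded at summit level. `SquareHodge N`
(`SoloBlindSquareForm`): for every smooth projective complex `N`-fold `X`, every rational class of
Hodge type `(N, N)` in `H^{2N}((X × X)(ℂ); ℂ)` is algebraic; `HodgeConjecture ↔ ∀ N, SquareHodge N`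
(`hodgeConjecture_iff_forall_squareHodge`). THEOREM (`squareHodge_of_succ`, `squareHodge_antitone`):
`SquareHodge (N + 1) → SquareHodge N`, so the set of levels at which the square form holds is a
DOWN-SET of `ℕ` containing `0` and `1` (`squareHodge_of_le_one`). Consequences: the summit is
equivalent to `SquareHodge N` for all LARGE `N` (`hodgeConjecture_iff_eventually_squareHodge`; the
tree already had "for infinitely many `N`"), and — the THRESHOLD FORM
(`not_hodgeConjecture_iff_exists_threshold`) — the Hodge conjecture fails if and only if there is a
level `N₁ ≥ 2` with `SquareHodge N ↔ N < N₁` for every `N`: below the threshold every Hodge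
self-correspondence of degree `0` of an `N`-fold is algebraic, at the threshold some `N₁`-fold's
square carries a non-algebraic rational `(N₁, N₁)`-class, and (`hodgeConjectureFor_of_squareHodge`)
every smooth projective variety of dimension `≤ (N₁ - 1)/2` satisfies the Hodge conjecture
(`hodgeConjectureFor_of_lt_threshold`).

Proof of `SquareHodge (N + 1) → SquareHodge N` (`squareHodge_of_succ`). Let `X` be a smooth
projective `N`-fold, `c` a rational `(N, N)`-class on the `2N`-fold `X × X`, and `P` a smooth
projective curve (`ℙ¹`).
* product step at `P` (`mem_algebraicClasses_of_prod_of_topDegree`, the product half of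
  Brosnan–Fang–Nie–Pearlstein's Lemma 48 with an arbitrary auxiliary factor: `c = λ⁻¹ pr_{1*}(pr₁^* c
  ∪ pr₂^* ρ)`, `ρ ≠ 0` the rational point class of `P`): it suffices that every rational
  `(N + 1, N + 1)`-class `a` on the `(2N + 1)`-fold `A = (X × X) × P` is algebraic;
* descent (`mem_algebraicClasses_left_of_map_fst_mem`: `pr₁^* a` algebraic `⟹ a` algebraic): it
  suffices that the rational `(N + 1, N + 1)`-class `pr₁^* a` on the `(2N + 2)`-fold `A × P` is
  algebraic — and `2N + 2` is the MIDDLE degree there;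
* transport (`forall_hodgeClass_mem_algebraicClasses_iff_of_iso`) along
  `τ : ((X × X) × P) × P ≅ (X × P) × (X × P)` (associators and one braiding of the cartesian
  monoidal structure of `Sch/ℂ`): that is `SquareHodge (N + 1)` at the `(N + 1)`-fold `X × P`.
Only "some smooth projective curve exists" is used of `P`.

What it buys (bookkeeping — a kernel-checked NORMAL FORM of the summit, not a reduction of
difficulty; compare `SoloBlindMiddleMonotone`, the same down-set structure for the middle-degree
chain `MiddleHodge m`, with which the square chain interleaves: `MiddleHodge N → SquareHodge N →
MiddleHodge m` for `3m ≤ N`): the square form of the Hodge conjecture is monotone in the dimension,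
so a counterexample among the degree-`0` Hodge self-correspondences of an `N`-fold propagates to all
larger dimensions (`not_squareHodge_of_le`), and the open problem has a well-defined THRESHOLD
`N₁ ∈ {2, 3, …} ∪ {∞}` (`N₁ = ∞` being the conjecture). The first open level is unchanged: `N = 2`,
the `(2,2)`-classes on self-products of surfaces.

## References

* [BrosnanFangNiePearlstein2009] P. Brosnan, H. Fang, Z. Nie, G. Pearlstein, Singularities of
  admissible normal functions, Invent. Math. 177 (2009), §6 Lemma 48 (arXiv:0711.0964, p. 13).
* [VoisinHodgeI2002] C. Voisin, Hodge Theory and Complex Algebraic Geometry I (2002), §7.3.2,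
  §11.3.3 Lemma 11.41.
* [Deligne2000] P. Deligne, The Hodge conjecture, Clay problem description (2000), §1.
-/

noncomputable section

open CategoryTheory CategoryTheory.Limits AlgebraicGeometry MonoidalCategory CartesianMonoidalCategory
open Literature.AlgebraicGeometry Literature.AlgebraicGeometry.Motives
open Literature.AlgebraicGeometry.HodgeTheory
open Literature.AlgebraicTopology.SingularHomology

namespace Summit.HodgeConjecture.HodgeConjecture.Theorems.SoloBlind

/-- **The square form is antitone, one step**: `SquareHodge (N + 1) → SquareHodge N`. For a rational
`(N, N)`-class `c` on `X × X` (`X` a smooth projective `N`-fold) and a smooth projective curve `P`: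
by the product step at `P` (`mem_algebraicClasses_of_prod_of_topDegree`) it suffices that the
rational `(N + 1, N + 1)`-classes `a` of the `(2N + 1)`-fold `(X × X) × P` are algebraic; by descent
(`mem_algebraicClasses_left_of_map_fst_mem`) it suffices that `pr₁^* a` is algebraic on the
`(2N + 2)`-fold `((X × X) × P) × P ≅ (X × P) × (X × P)` (`τ`: associators and one braiding), where the
degree `2N + 2` is the middle one — which is `SquareHodge (N + 1)` at the `(N + 1)`-fold `X × P`,
transported along `τ` (`forall_hodgeClass_mem_algebraicClasses_iff_of_iso`).
[cite: BrosnanFangNiePearlstein2009, §6 Lemma 48] [cite: VoisinHodgeI2002, §11.3.3 Lemma 11.41] -/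
theorem squareHodge_of_succ {N : ℕ} (h : SquareHodge (N + 1)) : SquareHodge N := by
  intro X hX c hc hpp
  -- a smooth projective curve `P` (the projective line)
  obtain ⟨P, hP⟩ : ∃ P : Motives.SchemeOver ℂ, Motives.IsSmoothProjective 1 P :=
    ⟨Motives.projectiveSpace 1 ℂ, Motives.isSmoothProjective_projectiveSpace_holds ℂ 1⟩
  -- `X × X` (a `2N`-fold), `A = (X × X) × P`, `A × P` (a `2(N + 1)`-fold), `X' = X × P`
  have hXX : Motives.IsSmoothProjective (N + N) (X ⊗ X) := Motives.IsSmoothProjective.tensor_holds hX hX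
  rw [← two_mul] at hXX
  have hA : Motives.IsSmoothProjective (2 * N + 1) ((X ⊗ X) ⊗ P) :=
    Motives.IsSmoothProjective.tensor_holds hXX hP
  have hAP : Motives.IsSmoothProjective (2 * N + 1 + 1) (((X ⊗ X) ⊗ P) ⊗ P) :=
    Motives.IsSmoothProjective.tensor_holds hA hP
  have e : 2 * N + 1 + 1 = 2 * (N + 1) := by ring
  rw [e] at hAP
  have hX' : Motives.IsSmoothProjective (N + 1) (X ⊗ P) := Motives.IsSmoothProjective.tensor_holds hX hP
  -- `τ : ((X × X) × P) × P ≅ (X × P) × (X × P)`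
  let τ : ((X ⊗ X) ⊗ P) ⊗ P ≅ (X ⊗ P) ⊗ (X ⊗ P) :=
    α_ (X ⊗ X) P P ≪≫ α_ X X (P ⊗ P) ≪≫
      whiskerLeftIso X ((α_ X P P).symm ≪≫ whiskerRightIso (β_ X P) P ≪≫ α_ P X P) ≪≫
        (α_ X P (X ⊗ P)).symm
  -- `SquareHodge (N + 1)` at `X × P`, transported along `τ`
  have hB := (forall_hodgeClass_mem_algebraicClasses_iff_of_iso τ (N + 1)).2 (h hX')
  -- the product step at `P` for the `2N`-fold `X × X`: reduce to classes `a` on `A = (X × X) × P`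
  refine mem_algebraicClasses_of_prod_of_topDegree hXX hP le_rfl (p := N) (q := N + 1)
    (N := 2 * N + 1) rfl rfl (fun a ha happ ↦ ?_) c hc hpp
  -- `pr₁^* a` on `A × P` is algebraic by the transported square hypothesis; descend along `pr₁`
  have halg : complexBetti.map (fst ((X ⊗ X) ⊗ P) P) (2 * (N + 1)) a ∈
      algebraicClasses (((X ⊗ X) ⊗ P) ⊗ P) (N + 1) :=
    hB _ (ha.map _) (happ.map_of_isSmoothProjective hAP hA (fst ((X ⊗ X) ⊗ P) P))
  exact mem_algebraicClasses_left_of_map_fst_mem hA hP halg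

/-- `SquareHodge` is antitone: `N ≤ N' → SquareHodge N' → SquareHodge N` (iterate
`squareHodge_of_succ`). [cite: BrosnanFangNiePearlstein2009, §6 Lemma 48] -/
theorem squareHodge_of_le {N N' : ℕ} (hNN' : N ≤ N') (h : SquareHodge N') : SquareHodge N := by
  induction hNN' with
  | refl => exact h
  | step _ ih => exact ih (squareHodge_of_succ h)

/-- `SquareHodge : ℕ → Prop` is an antitone family of statements (the order on `Prop` being
implication): its truth set is a down-set of `ℕ`. [cite: BrosnanFangNiePearlstein2009, §6 Lemma 48] -/
theorem squareHodge_antitone : Antitone SquareHodge := by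
  intro N N' hNN' h
  exact squareHodge_of_le hNN' h

/-- A counterexample propagates upward: if the square form fails at level `N` it fails at every
level `N' ≥ N`. [cite: BrosnanFangNiePearlstein2009, §6 Lemma 48] -/
theorem not_squareHodge_of_le {N N' : ℕ} (hNN' : N ≤ N') (h : ¬ SquareHodge N) : ¬ SquareHodge N' :=
  fun h' ↦ h (squareHodge_of_le hNN' h')

/-- **The summit from all large levels**: `HodgeConjecture ↔ ∃ N₀, ∀ N ≥ N₀, SquareHodge N`
(with `hodgeConjecture_iff_frequently_squareHodge`: from infinitely many levels).
[cite: Deligne2000, §1] [cite: BrosnanFangNiePearlstein2009, §6 Lemma 48] -/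
theorem hodgeConjecture_iff_eventually_squareHodge :
    _root_.HodgeConjecture ↔ ∃ N₀ : ℕ, ∀ N, N₀ ≤ N → SquareHodge N := by
  refine ⟨fun h ↦ ⟨0, fun N _ ↦ squareHodge_of_hodgeConjecture h N⟩, fun ⟨N₀, h⟩ ↦ ?_⟩
  exact hodgeConjecture_iff_frequently_squareHodge.mpr fun N₁ ↦
    ⟨max N₀ N₁, le_max_right _ _, h _ (le_max_left _ _)⟩

/-- **The first open level decides everything below it**: for `2 ≤ N`, `SquareHodge N` implies
`SquareHodge 2` — the `(2,2)`-classes on self-products `S × S` of surfaces (which contain the Hodge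
classes of `End(H²(S, ℚ))`) are the weakest open instance of the square chain.
[cite: VoisinHodgeI2002, §11.3.3] [cite: BrosnanFangNiePearlstein2009, §6 Lemma 48] -/
theorem squareHodge_two_of_two_le {N : ℕ} (hN : 2 ≤ N) (h : SquareHodge N) : SquareHodge 2 :=
  squareHodge_of_le hN h

/-- **Threshold form of the summit.** The Hodge conjecture FAILS if and only if the square chain has
a finite threshold: a level `N₁ ≥ 2` such that, for every `N`, `SquareHodge N ↔ N < N₁` (the truth
set of `SquareHodge` is a down-set containing `0, 1`, `squareHodge_of_le_one`, and it is all of `ℕ`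
iff the Hodge conjecture holds, `hodgeConjecture_iff_forall_squareHodge`).
[cite: Deligne2000, §1] [cite: BrosnanFangNiePearlstein2009, §6 Lemma 48] -/
theorem not_hodgeConjecture_iff_exists_threshold :
    ¬ _root_.HodgeConjecture ↔ ∃ N₁ : ℕ, 2 ≤ N₁ ∧ ∀ N, SquareHodge N ↔ N < N₁ := by
  classical
  constructor
  · intro h
    have hex : ∃ N, ¬ SquareHodge N := by
      by_contra hne
      push Not at hne
      exact h (hodgeConjecture_of_forall_squareHodge hne)
    refine ⟨Nat.find hex, ?_, fun N ↦ ⟨fun hN ↦ ?_, fun hN ↦ ?_⟩⟩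
    · by_contra hlt
      exact Nat.find_spec hex (squareHodge_of_le_one (by omega))
    · by_contra hle
      exact Nat.find_spec hex (squareHodge_of_le (by omega) hN)
    · by_contra hN'
      exact Nat.find_min hex hN hN'
  · rintro ⟨N₁, -, hN₁⟩ h
    exact lt_irrefl N₁ ((hN₁ N₁).1 (squareHodge_of_hodgeConjecture h N₁))

/-- **Below the threshold.** If `SquareHodge N ↔ N < N₁` for every `N`, then every smooth projective
variety of dimension `d` with `2d < N₁` satisfies the Hodge conjecture (`SquareHodge (N₁ - 1)` and
`hodgeConjectureFor_of_squareHodge`): a finite threshold `N₁` localises the first counterexample to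
the Hodge conjecture in dimensions `> (N₁ - 1)/2` and `≤ 2N₁` (the square of the bad `N₁`-fold).
[cite: Deligne2000, §1] [cite: BrosnanFangNiePearlstein2009, §6 Lemma 48] -/
theorem hodgeConjectureFor_of_lt_threshold {N₁ : ℕ} (hN₁ : ∀ N, SquareHodge N ↔ N < N₁)
    {d : ℕ} {Y : Motives.SchemeOver ℂ} (hY : Motives.IsSmoothProjective d Y) (hd : 2 * d < N₁) :
    HodgeConjectureFor d Y :=
  hodgeConjectureFor_of_squareHodge ((hN₁ (N₁ - 1)).2 (by omega)) hY (by omega)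

end Summit.HodgeConjecture.HodgeConjecture.Theorems.SoloBlind

end
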